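import Summits.RiemannHypothesis.RiemannHypothesis.Theorems.UniversalFactorNarrowKernelNoGoEnergyUpperCoeff
import Summits.RiemannHypothesis.RiemannHypothesis.Theorems.UniversalFactorNarrowKernelNoGoEnergyUpperError
import Summits.RiemannHypothesis.RiemannHypothesis.Theorems.UniversalFactorNarrowKernelNoGoEnergyUpperMain

/-!
# RiemannHypothesis / UniversalFactor — `NarrowKernelNoGo`, stub K1b (energy upper bound), part 6:
assembly for an abstract kernel

Route `RiemannHypothesis/UniversalFactor`, crux `NarrowKernelNoGo` (stmt-RiemannHypothesis-2576), line
`Sketch`, stub `stub_narrowEnergyUpper`. For an abstract kernel `k` (`|k| ≤ B e^{-2a|u|}`, transform `G` of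
`k e^{-πu/4}` with `‖G‖² ≤ G₀/(1+ω²)`, `G` `G₁`-Lipschitz) and an abstract envelope `E` (majorant and
asymptotics against `w(t) = t^{-7/4}e^{πt/4}`), the filtered Hardy function
`J(t) = w(t) ∫ k(u) E(t+u) Z(t+u) du` satisfies, with the global length `P = ⌊√(T/4π)⌋`:

`UniversalFactor.narrowUpper_J_eq` (`J = 2 Re V + R`), `UniversalFactor.narrowUpper_V_le`
(`‖V(t)‖ ≤ c₀ ‖D(t)‖ + 2√P C₃/t`), `UniversalFactor.narrowUpper_R_sq_le` (`R² ≤ (BC₀)²(∫K)∫K|e_P(t+u)|²`) and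
`UniversalFactor.narrowUpper_kernel_bound`: **`∫_T^{2T+1} J² ≤ C T`** as an integrable majorant `g ≥ J²`
on `(T, 2T+1]` with `∫ g ≤ C T`. Reference: Titchmarsh, *The Theory of the Riemann Zeta-Function* (1986),
§7.3–7.4, §9.20.
-/

noncomputable section

-- D-0017: `Summit.<S>.<S>.…` is the designed namespace of a single-problem summit.
set_option linter.dupNamespace false

namespace Summit.RiemannHypothesis.RiemannHypothesis.Theorems

open MeasureTheory Set Filter Complex intervalIntegral
open scoped Real Topology
open Literature.NumberTheory.LFunctions

/-- Expansion of the main part: with `c_n(t) = n^{-1/2} e^{-it log n}`,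
`k(u)E(t+u)w · E₁(t+u) S_P(t+u) = ∑_{n≤P} c_n(t) · (k(u)E(t+u)w · E₁(t+u) e^{-iu log n})`. [folklore] -/
theorem UniversalFactor.narrowUpper_mainPart_expand (r : ℝ) (P : ℕ) (t u : ℝ) :
    ((r : ℝ) : ℂ) * (TwistedMoment.thetaMainPhase (t + u) * TwistedMoment.mainSum P (t + u)) =
      ∑ n ∈ Finset.Icc 1 P, (((((n : ℝ) ^ (-(1 / 2 : ℝ))) : ℝ) : ℂ) * cexp (-(I * t * Real.log n))) *
        (((r : ℝ) : ℂ) * (TwistedMoment.thetaMainPhase (t + u) * cexp (-(I * u * Real.log n)))) := by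
  rw [TwistedMoment.mainSum_def, Finset.mul_sum, Finset.mul_sum]
  refine Finset.sum_congr rfl fun n _ => ?_
  have h : cexp (-(I * ((t + u : ℝ) : ℂ) * (Real.log n : ℂ))) =
      cexp (-(I * t * Real.log n)) * cexp (-(I * u * Real.log n)) := by
    rw [← Complex.exp_add]; congr 1; push_cast; ring
  rw [h]; ring

/-- **The main part against the frozen polynomial.** For `t ≥ max(T₀,1)` and every `P`:
`‖V(t)‖ ≤ c₀ ‖D(t)‖ + 2√P · C₃/t`, `V(t) = ∫ k(u)E(t+u)w(t) E₁(t+u)S_P(t+u) du`,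
`D(t) = ∑_{n≤P} n^{-1/2} e^{-it log n} G(½log(t/2π) − log n)`, `C₃ = B(C + c₀ + 2C₀ + 2c₀) M₃`. [folklore] -/
theorem UniversalFactor.narrowUpper_V_le {E k : ℝ → ℝ} {G : ℝ → ℂ} {B a C₀ c₀ C T₀ : ℝ} (ha : π / 8 < a)
    (hkm : Measurable k) (hk : ∀ u : ℝ, |k u| ≤ B * Real.exp (-(2 * a * |u|)))
    (hEc : Continuous E) (hE0 : ∀ τ : ℝ, 0 ≤ E τ)
    (hmaj : ∀ t : ℝ, 1 ≤ t → ∀ u : ℝ, E (t + u) * (t ^ (-(7 : ℝ) / 4) * Real.exp (π * t / 4)) ≤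
      C₀ * (2 + |u|) ^ 2 * Real.exp (-(π * u / 4)))
    (henv : ∀ t : ℝ, T₀ ≤ t → ∀ u : ℝ, |u| ≤ t / 2 →
      |E (t + u) * (t ^ (-(7 : ℝ) / 4) * Real.exp (π * t / 4)) - c₀ * Real.exp (-(π * u / 4))| ≤
        C * Real.exp (-(π * u / 4)) * (1 + |u|) / t)
    (hc₀ : 0 ≤ c₀)
    (hG5 : ∀ ω : ℝ, ∫ u : ℝ, ((k u * Real.exp (-(π * u / 4)) : ℝ) : ℂ) * cexp (↑(ω * u) * I) = G ω)
    {t : ℝ} (ht : max T₀ 1 ≤ t) (P : ℕ) :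
    ‖∫ u : ℝ, (((k u * (E (t + u) * (t ^ (-(7 : ℝ) / 4) * Real.exp (π * t / 4)))) : ℝ) : ℂ) *
        (TwistedMoment.thetaMainPhase (t + u) * TwistedMoment.mainSum P (t + u))‖ ≤
      c₀ * ‖∑ n ∈ Finset.Icc 1 P, ((((n : ℝ) ^ (-(1 / 2 : ℝ))) : ℝ) : ℂ) * cexp (-(I * t * Real.log n)) *
          G (1 / 2 * Real.log (t / (2 * π)) - Real.log n)‖ +
        2 * Real.sqrt P * (B * (C + c₀ + 2 * C₀ + 2 * c₀) *
          (∫ u : ℝ, (2 + |u|) ^ 3 * Real.exp (-((2 * a - π / 4) * |u|))) / t) := by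
  have ht1 : 1 ≤ t := (le_max_right _ _).trans ht
  have ht0 : 0 < t := by linarith
  set w := t ^ (-(7 : ℝ) / 4) * Real.exp (π * t / 4) with hw
  set L := 1 / 2 * Real.log (t / (2 * π)) with hL
  set C₃ := B * (C + c₀ + 2 * C₀ + 2 * c₀) * (∫ u : ℝ, (2 + |u|) ^ 3 * Real.exp (-((2 * a - π / 4) * |u|)))
    with hC₃
  set c : ℕ → ℂ := fun n => ((((n : ℝ) ^ (-(1 / 2 : ℝ))) : ℝ) : ℂ) * cexp (-(I * t * Real.log n)) with hc
  set f : ℕ → ℝ → ℂ := fun n u => (((k u * (E (t + u) * w)) : ℝ) : ℂ) *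
    (TwistedMoment.thetaMainPhase (t + u) * cexp (-(I * u * Real.log n))) with hf
  set γ : ℕ → ℂ := fun n => ∫ u : ℝ, f n u with hγ
  set β : ℕ → ℂ := fun n => TwistedMoment.thetaMainPhase t * (c₀ : ℂ) * G (L - Real.log n) with hβ
  have hf_int : ∀ n : ℕ, Integrable (f n) := fun n =>
    UniversalFactor.narrowUpper_integrable_coeff ha hkm hk hEc hE0 hmaj ht1 (Real.log n)
  -- `V = ∑ c_n γ_n`
  have hV : ∫ u : ℝ, (((k u * (E (t + u) * w)) : ℝ) : ℂ) *
      (TwistedMoment.thetaMainPhase (t + u) * TwistedMoment.mainSum P (t + u)) = ∑ n ∈ Finset.Icc 1 P, c n * γ n := by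
    rw [integral_congr_ae (Eventually.of_forall fun u =>
      UniversalFactor.narrowUpper_mainPart_expand (k u * (E (t + u) * w)) P t u),
      integral_finsetSum _ (fun n _ => (hf_int n).const_mul (c n))]
    exact Finset.sum_congr rfl fun n _ => MeasureTheory.integral_const_mul _ _
  -- `γ_n = β_n + O(C₃/t)`
  have hγβ : ∀ n ∈ Finset.Icc 1 P, ‖γ n - β n‖ ≤ C₃ / t := by
    intro n _
    have h := UniversalFactor.narrowUpper_coeff_approx_of ha hkm hk hEc hE0 hmaj henv hc₀ ht (Real.log n)
    rw [hG5] at h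
    exact h
  -- `∑ c_n β_n = E₁(t) c₀ D(t)`
  have hmain : ∑ n ∈ Finset.Icc 1 P, c n * β n = TwistedMoment.thetaMainPhase t * (c₀ : ℂ) *
      ∑ n ∈ Finset.Icc 1 P, ((((n : ℝ) ^ (-(1 / 2 : ℝ))) : ℝ) : ℂ) * cexp (-(I * t * Real.log n)) *
        G (L - Real.log n) := by
    rw [Finset.mul_sum]
    refine Finset.sum_congr rfl fun n _ => ?_
    simp only [hc, hβ]; ring
  have hsplit : ∑ n ∈ Finset.Icc 1 P, c n * γ n =
      ∑ n ∈ Finset.Icc 1 P, c n * β n + ∑ n ∈ Finset.Icc 1 P, c n * (γ n - β n) := by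
    rw [← Finset.sum_add_distrib]
    refine Finset.sum_congr rfl fun n _ => by ring
  rw [hV, hsplit]
  refine (norm_add_le _ _).trans (add_le_add ?_ ?_)
  · rw [hmain, norm_mul, norm_mul, TwistedMoment.norm_thetaMainPhase, one_mul, Complex.norm_real,
      Real.norm_eq_abs, abs_of_nonneg hc₀]
  · refine (norm_sum_le _ _).trans ?_
    have hterm : ∀ n ∈ Finset.Icc 1 P, ‖c n * (γ n - β n)‖ ≤ (n : ℝ) ^ (-(1 / 2 : ℝ)) * (C₃ / t) := by
      intro n hn
      rw [norm_mul, hc, UniversalFactor.narrowUpper_norm_coef_mul_cexp (Finset.mem_Icc.1 hn).1]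
      exact mul_le_mul_of_nonneg_left (hγβ n hn) (Real.rpow_nonneg (Nat.cast_nonneg n) _)
    refine (Finset.sum_le_sum hterm).trans ?_
    rw [← Finset.sum_mul]
    have hC₃ : 0 ≤ C₃ / t := by
      obtain ⟨hB, hC0, hC⟩ := UniversalFactor.narrowUpper_consts_nonneg hk hE0 hmaj henv
      have := UniversalFactor.narrowUpper_moment_nonneg (2 * a - π / 4) 3
      positivity
    calc (∑ n ∈ Finset.Icc 1 P, (n : ℝ) ^ (-(1 / 2 : ℝ))) * (C₃ / t) ≤ (2 * Real.sqrt P) * (C₃ / t) :=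
          mul_le_mul_of_nonneg_right (AFE.sum_Icc_rpow_neg_half_le P) hC₃
      _ = 2 * Real.sqrt P * (C₃ / t) := by ring

/-- `‖e_P(t+u)‖ ≤ (2 + 2|t| + 4√P)(2 + |u|)`. [folklore] -/
theorem UniversalFactor.narrowUpper_norm_hardyZErr_shift_le (P : ℕ) (t u : ℝ) :
    ‖TwistedMoment.hardyZErr P (t + u)‖ ≤ (2 + 2 * |t| + 4 * Real.sqrt P) * (2 + |u|) := by
  have h := UniversalFactor.narrowUpper_norm_hardyZErr_le_crude P (t + u)
  nlinarith [abs_nonneg t, abs_nonneg u, abs_add_le t u, Real.sqrt_nonneg (P : ℝ)]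

/-- **`J = 2 Re V + R`.** For `t ≥ 1`:
`(∫ k(u) E(t+u) Z(t+u) du) · w(t) = 2 Re ∫ k E w · E₁S_P(t+u) du + ∫ k E w · Re e_P(t+u) du`. [folklore] -/
theorem UniversalFactor.narrowUpper_J_eq {E k : ℝ → ℝ} {B a C₀ : ℝ} (ha : π / 8 < a)
    (hkm : Measurable k) (hk : ∀ u : ℝ, |k u| ≤ B * Real.exp (-(2 * a * |u|)))
    (hEc : Continuous E) (hE0 : ∀ τ : ℝ, 0 ≤ E τ)
    (hmaj : ∀ t : ℝ, 1 ≤ t → ∀ u : ℝ, E (t + u) * (t ^ (-(7 : ℝ) / 4) * Real.exp (π * t / 4)) ≤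
      C₀ * (2 + |u|) ^ 2 * Real.exp (-(π * u / 4)))
    {t : ℝ} (ht1 : 1 ≤ t) (P : ℕ) :
    (∫ u : ℝ, k u * E (t + u) * hardyZ (t + u)) * (t ^ (-(7 : ℝ) / 4) * Real.exp (π * t / 4)) =
      2 * (∫ u : ℝ, (((k u * (E (t + u) * (t ^ (-(7 : ℝ) / 4) * Real.exp (π * t / 4)))) : ℝ) : ℂ) *
          (TwistedMoment.thetaMainPhase (t + u) * TwistedMoment.mainSum P (t + u))).re +
        ∫ u : ℝ, k u * (E (t + u) * (t ^ (-(7 : ℝ) / 4) * Real.exp (π * t / 4))) *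
          (TwistedMoment.hardyZErr P (t + u)).re := by
  have ht0 : 0 < t := by linarith
  have hc : 0 < 2 * a - π / 4 := by linarith
  set w := t ^ (-(7 : ℝ) / 4) * Real.exp (π * t / 4) with hw
  have hw0 : 0 < w := UniversalFactor.narrowUpper_weight_pos ht0
  set F₁ : ℝ → ℂ := fun u => (((k u * (E (t + u) * w)) : ℝ) : ℂ) *
    (TwistedMoment.thetaMainPhase (t + u) * TwistedMoment.mainSum P (t + u)) with hF₁
  set g₂ : ℝ → ℝ := fun u => k u * (E (t + u) * w) * (TwistedMoment.hardyZErr P (t + u)).re with hg₂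
  -- integrability
  have hF₁i : Integrable F₁ := by
    have heq : F₁ = fun u => ∑ n ∈ Finset.Icc 1 P, (((((n : ℝ) ^ (-(1 / 2 : ℝ))) : ℝ) : ℂ) *
        cexp (-(I * t * Real.log n))) * ((((k u * (E (t + u) * w)) : ℝ) : ℂ) *
          (TwistedMoment.thetaMainPhase (t + u) * cexp (-(I * u * Real.log n)))) :=
      funext fun u => UniversalFactor.narrowUpper_mainPart_expand _ P t u
    rw [heq]
    exact integrable_finsetSum _ fun n _ =>
      (UniversalFactor.narrowUpper_integrable_coeff ha hkm hk hEc hE0 hmaj ht1 (Real.log n)).const_mul _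
  have hEw_meas : Measurable fun u : ℝ => k u * (E (t + u) * w) :=
    hkm.mul (((hEc.comp ((continuous_const.add continuous_id))).mul continuous_const).measurable)
  have hg₂i : Integrable g₂ := by
    have hmeas : AEStronglyMeasurable g₂ volume := by
      refine (hEw_meas.mul ?_).aestronglyMeasurable
      exact (Complex.continuous_re.comp ((UniversalFactor.narrowUpper_continuous_hardyZErr P).comp
        (continuous_const.add continuous_id))).measurable
    refine UniversalFactor.narrowUpper_integrable_of_le hmeas hc (B * C₀ * (2 + 2 * |t| + 4 * Real.sqrt P)) 3
      fun u => ?_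
    rw [hg₂, Real.norm_eq_abs, abs_mul, abs_mul, abs_of_nonneg (mul_nonneg (hE0 _) hw0.le)]
    have hK := UniversalFactor.narrowUpper_kernel_majorant hmaj hE0 hk ht1 u
    have he := (abs_re_le_norm _).trans (UniversalFactor.narrowUpper_norm_hardyZErr_shift_le P t u)
    calc |k u| * (E (t + u) * w) * |(TwistedMoment.hardyZErr P (t + u)).re|
        ≤ (B * C₀ * ((2 + |u|) ^ 2 * Real.exp (-((2 * a - π / 4) * |u|)))) *
            ((2 + 2 * |t| + 4 * Real.sqrt P) * (2 + |u|)) :=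
          mul_le_mul hK he (abs_nonneg _) ((mul_nonneg (abs_nonneg _) (mul_nonneg (hE0 _) hw0.le)).trans hK)
      _ = B * C₀ * (2 + 2 * |t| + 4 * Real.sqrt P) * ((2 + |u|) ^ 3 * Real.exp (-((2 * a - π / 4) * |u|))) := by
          ring
  -- pointwise identity
  have hpt : ∀ u : ℝ, k u * E (t + u) * hardyZ (t + u) * w = 2 * (F₁ u).re + g₂ u := by
    intro u
    simp only [hF₁, hg₂, Complex.re_ofReal_mul]
    rw [UniversalFactor.narrowUpper_hardyZ_eq P (t + u)]
    ring
  have hF₁re : Integrable (fun u => (F₁ u).re) := hF₁i.re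
  rw [← MeasureTheory.integral_mul_const]
  simp_rw [hpt]
  rw [integral_add (hF₁re.const_mul 2) hg₂i, MeasureTheory.integral_const_mul]
  congr 2
  have h := integral_re hF₁i
  simpa only [RCLike.re_to_complex] using h

/-- **`R(t)² ≤ (BC₀)² (∫K) · ∫ K(u)|e_P(t+u)|² du`** (Cauchy–Schwarz against the kernel majorant
`K(u) = (2+|u|)² e^{-(2a−π/4)|u|}`), `t ≥ 1`. [folklore] -/
theorem UniversalFactor.narrowUpper_R_sq_le {E k : ℝ → ℝ} {B a C₀ : ℝ} (ha : π / 8 < a)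
    (hk : ∀ u : ℝ, |k u| ≤ B * Real.exp (-(2 * a * |u|))) (hE0 : ∀ τ : ℝ, 0 ≤ E τ)
    (hmaj : ∀ t : ℝ, 1 ≤ t → ∀ u : ℝ, E (t + u) * (t ^ (-(7 : ℝ) / 4) * Real.exp (π * t / 4)) ≤
      C₀ * (2 + |u|) ^ 2 * Real.exp (-(π * u / 4)))
    {t : ℝ} (ht1 : 1 ≤ t) (P : ℕ) :
    (∫ u : ℝ, k u * (E (t + u) * (t ^ (-(7 : ℝ) / 4) * Real.exp (π * t / 4))) *
        (TwistedMoment.hardyZErr P (t + u)).re) ^ 2 ≤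
      (B * C₀) ^ 2 * (∫ u : ℝ, (2 + |u|) ^ 2 * Real.exp (-((2 * a - π / 4) * |u|))) *
        ∫ u : ℝ, (2 + |u|) ^ 2 * Real.exp (-((2 * a - π / 4) * |u|)) * ‖TwistedMoment.hardyZErr P (t + u)‖ ^ 2 := by
  have ht0 : 0 < t := by linarith
  have hc : 0 < 2 * a - π / 4 := by linarith
  set w := t ^ (-(7 : ℝ) / 4) * Real.exp (π * t / 4) with hw
  have hw0 : 0 < w := UniversalFactor.narrowUpper_weight_pos ht0
  set K : ℝ → ℝ := fun u => B * C₀ * ((2 + |u|) ^ 2 * Real.exp (-((2 * a - π / 4) * |u|))) with hK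
  set h : ℝ → ℝ := fun u => (TwistedMoment.hardyZErr P (t + u)).re with hh
  set M := 2 + 2 * |t| + 4 * Real.sqrt P with hM
  have hM0 : 0 ≤ M := by have := Real.sqrt_nonneg (P:ℝ); positivity
  have hρK : ∀ u, |k u * (E (t + u) * w)| ≤ K u := by
    intro u
    rw [abs_mul, abs_of_nonneg (mul_nonneg (hE0 _) hw0.le)]
    exact UniversalFactor.narrowUpper_kernel_majorant hmaj hE0 hk ht1 u
  have hKint : Integrable K := (UniversalFactor.narrowUpper_integrable_pow_mul_exp hc 2).const_mul _
  have hBC : 0 ≤ B * C₀ := by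
    have h0 := (abs_nonneg _).trans (hρK 0)
    simp only [hK, abs_zero, add_zero] at h0
    have : (0:ℝ) < (2:ℝ) ^ 2 * Real.exp (-((2 * a - π / 4) * 0)) := by positivity
    nlinarith
  have hec : Continuous fun u : ℝ => TwistedMoment.hardyZErr P (t + u) :=
    (UniversalFactor.narrowUpper_continuous_hardyZErr P).comp (continuous_const.add continuous_id)
  have hnorm_le : ∀ u, ‖TwistedMoment.hardyZErr P (t + u)‖ ≤ M * (2 + |u|) := fun u =>
    UniversalFactor.narrowUpper_norm_hardyZErr_shift_le P t u
  have hKh : Integrable fun u => K u * |h u| := by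
    refine UniversalFactor.narrowUpper_integrable_of_le (Continuous.aestronglyMeasurable (by
      simp only [hK, hh]; exact (by fun_prop : Continuous fun u => B * C₀ * ((2 + |u|) ^ 2 *
        Real.exp (-((2 * a - π / 4) * |u|)))).mul ((Complex.continuous_re.comp hec).abs))) hc (B * C₀ * M) 3
      fun u => ?_
    rw [Real.norm_eq_abs, abs_mul, abs_abs, abs_of_nonneg ((abs_nonneg _).trans (hρK u))]
    have h1 : |h u| ≤ M * (2 + |u|) := (abs_re_le_norm _).trans (hnorm_le u)
    calc K u * |h u| ≤ K u * (M * (2 + |u|)) := mul_le_mul_of_nonneg_left h1 ((abs_nonneg _).trans (hρK u))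
      _ = B * C₀ * M * ((2 + |u|) ^ 3 * Real.exp (-((2 * a - π / 4) * |u|))) := by simp only [hK]; ring
  have hKe2 : Integrable fun u => K u * ‖TwistedMoment.hardyZErr P (t + u)‖ ^ 2 := by
    refine UniversalFactor.narrowUpper_integrable_of_le (Continuous.aestronglyMeasurable (by
      simp only [hK]; exact (by fun_prop : Continuous fun u => B * C₀ * ((2 + |u|) ^ 2 *
        Real.exp (-((2 * a - π / 4) * |u|)))).mul (hec.norm.pow 2))) hc (B * C₀ * M ^ 2) 4 fun u => ?_
    rw [Real.norm_eq_abs, abs_mul, abs_of_nonneg ((abs_nonneg _).trans (hρK u)), abs_of_nonneg (by positivity)]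
    have h1 : ‖TwistedMoment.hardyZErr P (t + u)‖ ^ 2 ≤ (M * (2 + |u|)) ^ 2 :=
      pow_le_pow_left₀ (norm_nonneg _) (hnorm_le u) 2
    calc K u * ‖TwistedMoment.hardyZErr P (t + u)‖ ^ 2 ≤ K u * (M * (2 + |u|)) ^ 2 :=
          mul_le_mul_of_nonneg_left h1 ((abs_nonneg _).trans (hρK u))
      _ = B * C₀ * M ^ 2 * ((2 + |u|) ^ 4 * Real.exp (-((2 * a - π / 4) * |u|))) := by simp only [hK]; ring
  have hK0 : ∀ u, 0 ≤ K u := fun u => (abs_nonneg _).trans (hρK u)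
  have hh2 : ∀ u, h u ^ 2 ≤ ‖TwistedMoment.hardyZErr P (t + u)‖ ^ 2 := fun u => by
    simpa only [hh, sq_abs] using
      pow_le_pow_left₀ (abs_nonneg _) (abs_re_le_norm (TwistedMoment.hardyZErr P (t + u))) 2
  have hKh2 : Integrable fun u => K u * h u ^ 2 := by
    refine UniversalFactor.narrowUpper_integrable_of_le (Continuous.aestronglyMeasurable (by
      simp only [hK, hh]; exact (by fun_prop : Continuous fun u => B * C₀ * ((2 + |u|) ^ 2 *
        Real.exp (-((2 * a - π / 4) * |u|)))).mul ((Complex.continuous_re.comp hec).pow 2))) hc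
      (B * C₀ * M ^ 2) 4 fun u => ?_
    rw [Real.norm_eq_abs, abs_mul, abs_of_nonneg (hK0 u), abs_of_nonneg (sq_nonneg _)]
    have h1 : ‖TwistedMoment.hardyZErr P (t + u)‖ ^ 2 ≤ (M * (2 + |u|)) ^ 2 :=
      pow_le_pow_left₀ (norm_nonneg _) (hnorm_le u) 2
    calc K u * h u ^ 2 ≤ K u * (M * (2 + |u|)) ^ 2 := mul_le_mul_of_nonneg_left ((hh2 u).trans h1) (hK0 u)
      _ = B * C₀ * M ^ 2 * ((2 + |u|) ^ 4 * Real.exp (-((2 * a - π / 4) * |u|))) := by simp only [hK]; ring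
  have hcs := UniversalFactor.narrowUpper_weighted_cs_of hρK hKint hKh hKh2
  have hKh2_le : ∫ u, K u * h u ^ 2 ≤ ∫ u, K u * ‖TwistedMoment.hardyZErr P (t + u)‖ ^ 2 :=
    integral_mono hKh2 hKe2 fun u => mul_le_mul_of_nonneg_left (hh2 u) (hK0 u)
  have hA : ∫ u, K u = B * C₀ * ∫ u : ℝ, (2 + |u|) ^ 2 * Real.exp (-((2 * a - π / 4) * |u|)) :=
    MeasureTheory.integral_const_mul _ _
  have hBint : ∫ u, K u * ‖TwistedMoment.hardyZErr P (t + u)‖ ^ 2 = B * C₀ *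
      ∫ u : ℝ, (2 + |u|) ^ 2 * Real.exp (-((2 * a - π / 4) * |u|)) * ‖TwistedMoment.hardyZErr P (t + u)‖ ^ 2 := by
    rw [← MeasureTheory.integral_const_mul]
    refine integral_congr_ae (Eventually.of_forall fun u => by simp only [hK]; ring)
  have hA0 : 0 ≤ ∫ u, K u := integral_nonneg hK0
  calc (∫ u : ℝ, k u * (E (t + u) * w) * h u) ^ 2 ≤ (∫ u, K u) * ∫ u, K u * h u ^ 2 := hcs
    _ ≤ (∫ u, K u) * ∫ u, K u * ‖TwistedMoment.hardyZErr P (t + u)‖ ^ 2 :=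
        mul_le_mul_of_nonneg_left hKh2_le hA0
    _ = _ := by rw [hA, hBint]; ring

/-- The final pointwise arithmetic: `|x| ≤ ‖V‖ ≤ c₀ n_D + 2C₃` and `y² ≤ X` give
`(2x + y)² ≤ 16 c₀² n_D² + 64 C₃² + 2X`. [folklore] -/
theorem UniversalFactor.narrowUpper_sq_arith {x y nV nD C₃ c₀ X : ℝ} (h1 : |x| ≤ nV)
    (h2 : nV ≤ c₀ * nD + 2 * C₃) (h3 : y ^ 2 ≤ X) :
    (2 * x + y) ^ 2 ≤ 16 * c₀ ^ 2 * nD ^ 2 + 64 * C₃ ^ 2 + 2 * X := by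
  have h4 : x ^ 2 ≤ (c₀ * nD + 2 * C₃) ^ 2 := by
    have := pow_le_pow_left₀ (abs_nonneg x) (h1.trans h2) 2
    rwa [sq_abs] at this
  nlinarith [sq_nonneg (2 * x - y), sq_nonneg (c₀ * nD - 2 * C₃)]

/-- **The filtered Hardy function in mean square, abstract kernel.** Under the kernel bound
`|k| ≤ B e^{-2a|u|}` (`k` measurable, `a > π/8`), the transform identities `∫ k e^{-πu/4} e^{iωu} = G(ω)`
with `‖G(ω)‖² ≤ G₀/(1+ω²)` and `‖G(ω) − G(ω')‖ ≤ G₁|ω−ω'|`, and the envelope majorant/asymptotics for a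
continuous `E ≥ 0`: there are `C, T₁` such that for `T ≥ T₁` the square of
`J(t) = (∫ k(u)E(t+u)Z(t+u) du) · t^{-7/4}e^{πt/4}` has an integrable majorant `g` on `(T, 2T+1]` with
`∫ g ≤ C T` — in particular `∫_T^{2T+1} J² ≤ C T`, with NO `log T`. [folklore] -/
theorem UniversalFactor.narrowUpper_kernel_bound_of {E k : ℝ → ℝ} {G : ℝ → ℂ} {B a C₀ c₀ C T₀ G₀ G₁ : ℝ}
    (ha : π / 8 < a) (hkm : Measurable k) (hk : ∀ u : ℝ, |k u| ≤ B * Real.exp (-(2 * a * |u|)))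
    (hEc : Continuous E) (hE0 : ∀ τ : ℝ, 0 ≤ E τ)
    (hmaj : ∀ t : ℝ, 1 ≤ t → ∀ u : ℝ, E (t + u) * (t ^ (-(7 : ℝ) / 4) * Real.exp (π * t / 4)) ≤
      C₀ * (2 + |u|) ^ 2 * Real.exp (-(π * u / 4)))
    (henv : ∀ t : ℝ, T₀ ≤ t → ∀ u : ℝ, |u| ≤ t / 2 →
      |E (t + u) * (t ^ (-(7 : ℝ) / 4) * Real.exp (π * t / 4)) - c₀ * Real.exp (-(π * u / 4))| ≤
        C * Real.exp (-(π * u / 4)) * (1 + |u|) / t)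
    (hc₀ : 0 ≤ c₀)
    (hG5 : ∀ ω : ℝ, ∫ u : ℝ, ((k u * Real.exp (-(π * u / 4)) : ℝ) : ℂ) * cexp (↑(ω * u) * I) = G ω)
    (hG3 : ∀ ω : ℝ, ‖G ω‖ ^ 2 ≤ G₀ / (1 + ω ^ 2)) (hG4 : ∀ ω ω' : ℝ, ‖G ω - G ω'‖ ≤ G₁ * |ω - ω'|)
    (hG₀ : 0 ≤ G₀) (hG₁ : 0 ≤ G₁) :
    ∃ C' T₁ : ℝ, ∀ T : ℝ, T₁ ≤ T → ∃ g : ℝ → ℝ, IntegrableOn g (Ioc T (2 * T + 1)) ∧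
      (∀ t ∈ Icc T (2 * T + 1), ((∫ u : ℝ, k u * E (t + u) * hardyZ (t + u)) *
          (t ^ (-(7 : ℝ) / 4) * Real.exp (π * t / 4))) ^ 2 ≤ g t) ∧
      ∫ t in Ioc T (2 * T + 1), g t ≤ C' * T := by
  have hc : 0 < 2 * a - π / 4 := by linarith
  obtain ⟨C_e, T_e, hCe, hTe, herr⟩ := UniversalFactor.narrowUpper_err_meanSquare hc
  obtain ⟨hB, hC0, hC⟩ := UniversalFactor.narrowUpper_consts_nonneg hk hE0 hmaj henv
  set M₂ := ∫ u : ℝ, (2 + |u|) ^ 2 * Real.exp (-((2 * a - π / 4) * |u|)) with hM₂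
  set M₃ := ∫ u : ℝ, (2 + |u|) ^ 3 * Real.exp (-((2 * a - π / 4) * |u|)) with hM₃
  set M₅ := ∫ u : ℝ, (2 + |u|) ^ 5 * Real.exp (-((2 * a - π / 4) * |u|)) with hM₅
  have hM₂0 : 0 ≤ M₂ := UniversalFactor.narrowUpper_moment_nonneg _ _
  have hM₃0 : 0 ≤ M₃ := UniversalFactor.narrowUpper_moment_nonneg _ _
  have hM₅0 : 0 ≤ M₅ := UniversalFactor.narrowUpper_moment_nonneg _ _
  set C₃ := B * (C + c₀ + 2 * C₀ + 2 * c₀) * M₃ with hC₃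
  have hC₃0 : 0 ≤ C₃ := by positivity
  set C_D := 690 * (G₀ * (1 + 3 * π)) + 16 * G₁ ^ 2 with hCD
  have hCD0 : 0 ≤ C_D := by positivity
  refine ⟨16 * c₀ ^ 2 * C_D + 128 * C₃ ^ 2 + 2 * ((B * C₀) ^ 2 * M₂ * (C_e * M₅)), max (max T₀ 1) T_e,
    fun T hT => ?_⟩
  have hT01 : max T₀ 1 ≤ T := (le_max_left _ _).trans hT
  have hT1 : 1 ≤ T := (le_max_right _ _).trans hT01
  have hTe' : T_e ≤ T := (le_max_right _ _).trans hT
  have hT0 : 0 < T := by linarith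
  have hTle : T ≤ 2 * T + 1 := by linarith
  obtain ⟨hΦint, hΦle⟩ := herr T hTe'
  set P := ⌊Real.sqrt (T / 2 / (2 * π))⌋₊ with hP
  have hPT : (P : ℝ) ≤ Real.sqrt T := (Nat.floor_le (Real.sqrt_nonneg _)).trans (Real.sqrt_le_sqrt (by
    rw [div_div, div_le_iff₀ (by positivity)]; nlinarith [Real.pi_gt_three]))
  have hsT : Real.sqrt T ≤ T := by nlinarith [Real.sq_sqrt hT0.le, Real.sqrt_nonneg T, Real.one_le_sqrt.2 hT1]
  set D : ℝ → ℂ := fun t => ∑ n ∈ Finset.Icc 1 P, ((((n : ℝ) ^ (-(1 / 2 : ℝ))) : ℝ) : ℂ) *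
    cexp (-(I * t * Real.log n)) * G (1 / 2 * Real.log (t / (2 * π)) - Real.log n) with hD
  set Φ : ℝ → ℝ := fun t => ∫ u : ℝ, (2 + |u|) ^ 2 * Real.exp (-((2 * a - π / 4) * |u|)) *
    ‖TwistedMoment.hardyZErr P (t + u)‖ ^ 2 with hΦ
  set g : ℝ → ℝ := fun t => 16 * c₀ ^ 2 * ‖D t‖ ^ 2 + 64 * C₃ ^ 2 + 2 * ((B * C₀) ^ 2 * M₂ * Φ t) with hg
  have hDc : ContinuousOn (fun t => ‖D t‖ ^ 2) (Icc T (2 * T + 1)) :=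
    (((UniversalFactor.narrowUpper_continuousOn_main hG4 P).mono fun t ht => hT0.trans_le ht.1).norm).pow 2
  have hDint : IntegrableOn (fun t => ‖D t‖ ^ 2) (Ioc T (2 * T + 1)) :=
    hDc.integrableOn_Icc.mono_set Ioc_subset_Icc_self
  have h2int : IntegrableOn (fun _ : ℝ => 64 * C₃ ^ 2) (Ioc T (2 * T + 1)) := integrable_const _
  have hΦint' : IntegrableOn (fun t => 2 * ((B * C₀) ^ 2 * M₂ * Φ t)) (Ioc T (2 * T + 1)) :=
    (hΦint.const_mul ((B * C₀) ^ 2 * M₂)).const_mul 2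
  refine ⟨g, ((hDint.const_mul (16 * c₀ ^ 2)).add h2int).add hΦint', fun t ht => ?_, ?_⟩
  · -- pointwise: `J² ≤ g`
    have htT : T ≤ t := ht.1
    have ht01 : max T₀ 1 ≤ t := hT01.trans htT
    have ht1 : 1 ≤ t := hT1.trans htT
    have ht0 : 0 < t := by linarith
    have hJ := UniversalFactor.narrowUpper_J_eq ha hkm hk hEc hE0 hmaj ht1 P
    have hV := UniversalFactor.narrowUpper_V_le ha hkm hk hEc hE0 hmaj henv hc₀ hG5 ht01 P
    have hR := UniversalFactor.narrowUpper_R_sq_le ha hk hE0 hmaj ht1 P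
    have hDt : (∑ n ∈ Finset.Icc 1 P, ((((n : ℝ) ^ (-(1 / 2 : ℝ))) : ℝ) : ℂ) * cexp (-(I * t * Real.log n)) *
        G (1 / 2 * Real.log (t / (2 * π)) - Real.log n)) = D t := rfl
    have hΦt : (∫ u : ℝ, (2 + |u|) ^ 2 * Real.exp (-((2 * a - π / 4) * |u|)) *
        ‖TwistedMoment.hardyZErr P (t + u)‖ ^ 2) = Φ t := rfl
    rw [hDt] at hV
    rw [hΦt] at hR
    have hsqrtP : Real.sqrt P ≤ t := by
      have h1 : Real.sqrt P ≤ Real.sqrt (Real.sqrt T) := Real.sqrt_le_sqrt hPT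
      have h2 : Real.sqrt (Real.sqrt T) ≤ Real.sqrt T := Real.sqrt_le_sqrt hsT
      linarith
    have hq : Real.sqrt P / t ≤ 1 := (div_le_one ht0).2 hsqrtP
    have hV' := hV.trans (show c₀ * ‖D t‖ + 2 * Real.sqrt P * (C₃ / t) ≤ c₀ * ‖D t‖ + 2 * C₃ by
      rw [show 2 * Real.sqrt P * (C₃ / t) = 2 * C₃ * (Real.sqrt P / t) by ring]
      nlinarith)
    rw [hJ]
    exact UniversalFactor.narrowUpper_sq_arith (abs_re_le_norm _) hV' hR
  · -- the integral of `g`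
    have hmain : ∫ t in Ioc T (2 * T + 1), ‖D t‖ ^ 2 ≤ C_D * T := by
      rw [← intervalIntegral.integral_of_le hTle]
      exact UniversalFactor.narrowUpper_main_meanSquare_of hG3 hG4 hG₀ hG₁ hT1 P hPT
    have hA : Integrable (fun t => 16 * c₀ ^ 2 * ‖D t‖ ^ 2 + 64 * C₃ ^ 2) (volume.restrict (Ioc T (2 * T + 1))) :=
      (hDint.const_mul (16 * c₀ ^ 2)).add h2int
    have e1 : ∫ t in Ioc T (2 * T + 1), g t = ∫ t in Ioc T (2 * T + 1),
        ((16 * c₀ ^ 2 * ‖D t‖ ^ 2 + 64 * C₃ ^ 2) + 2 * ((B * C₀) ^ 2 * M₂ * Φ t)) := rfl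
    have hsplit : ∫ t in Ioc T (2 * T + 1), g t = 16 * c₀ ^ 2 * (∫ t in Ioc T (2 * T + 1), ‖D t‖ ^ 2) +
        64 * C₃ ^ 2 * (2 * T + 1 - T) + 2 * ((B * C₀) ^ 2 * M₂ * ∫ t in Ioc T (2 * T + 1), Φ t) := by
      rw [e1, integral_add hA hΦint', integral_add (hDint.const_mul _) h2int,
        MeasureTheory.integral_const_mul, MeasureTheory.integral_const_mul, MeasureTheory.integral_const_mul,
        MeasureTheory.integral_const_mul, setIntegral_const, Real.volume_real_Ioc_of_le hTle, smul_eq_mul]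
      ring
    rw [hsplit]
    have h1 : 16 * c₀ ^ 2 * ∫ t in Ioc T (2 * T + 1), ‖D t‖ ^ 2 ≤ 16 * c₀ ^ 2 * (C_D * T) :=
      mul_le_mul_of_nonneg_left hmain (by positivity)
    have h2 : 64 * C₃ ^ 2 * (2 * T + 1 - T) ≤ 128 * C₃ ^ 2 * T := by
      have h := mul_le_mul_of_nonneg_left (by linarith : 2 * T + 1 - T ≤ 2 * T) (by positivity : 0 ≤ 64 * C₃ ^ 2)
      linarith
    have h3 : 2 * ((B * C₀) ^ 2 * M₂ * ∫ t in Ioc T (2 * T + 1), Φ t) ≤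
        2 * ((B * C₀) ^ 2 * M₂ * (C_e * M₅ * T)) := by
      have := mul_le_mul_of_nonneg_left hΦle (by positivity : 0 ≤ (B * C₀) ^ 2 * M₂)
      linarith
    calc 16 * c₀ ^ 2 * (∫ t in Ioc T (2 * T + 1), ‖D t‖ ^ 2) + 64 * C₃ ^ 2 * (2 * T + 1 - T) +
          2 * ((B * C₀) ^ 2 * M₂ * ∫ t in Ioc T (2 * T + 1), Φ t)
        ≤ 16 * c₀ ^ 2 * (C_D * T) + 128 * C₃ ^ 2 * T + 2 * ((B * C₀) ^ 2 * M₂ * (C_e * M₅ * T)) := by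
          linarith
      _ = (16 * c₀ ^ 2 * C_D + 128 * C₃ ^ 2 + 2 * ((B * C₀) ^ 2 * M₂ * (C_e * M₅))) * T := by ring

/-- **Registered sub-stub `narrowUpper_kernel_bound`** (verbatim signature): the filtered Hardy function in mean square
for an abstract kernel — an integrable majorant `g ≥ J²` on `(T, 2T+1]` with `∫ g ≤ C T`. [folklore] -/
theorem UniversalFactor.narrowUpper_kernel_bound : ∀ {E k : ℝ → ℝ} {G : ℝ → ℂ} {B a C₀ c₀ C T₀ G₀ G₁ : ℝ}, Real.pi / 8 < a → Measurable k → (∀ u : ℝ, |k u| ≤ B * Real.exp (-(2 * a * |u|))) → Continuous E → (∀ τ : ℝ, 0 ≤ E τ) → (∀ t : ℝ, 1 ≤ t → ∀ u : ℝ, E (t + u) * (t ^ (-(7 : ℝ) / 4) * Real.exp (Real.pi * t / 4)) ≤ C₀ * (2 + |u|) ^ 2 * Real.exp (-(Real.pi * u / 4))) → (∀ t : ℝ, T₀ ≤ t → ∀ u : ℝ, |u| ≤ t / 2 → |E (t + u) * (t ^ (-(7 : ℝ) / 4) * Real.exp (Real.pi * t / 4)) - c₀ * Real.exp (-(Real.pi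 * u / 4))| ≤ C * Real.exp (-(Real.pi * u / 4)) * (1 + |u|) / t) → 0 ≤ c₀ → (∀ ω : ℝ, ∫ u : ℝ, ((k u * Real.exp (-(Real.pi * u / 4)) : ℝ) : ℂ) * Complex.exp (↑(ω * u) * Complex.I) = G ω) → (∀ ω : ℝ, ‖G ω‖ ^ 2 ≤ G₀ / (1 + ω ^ 2)) → (∀ ω ω' : ℝ, ‖G ω - G ω'‖ ≤ G₁ * |ω - ω'|) → 0 ≤ G₀ → 0 ≤ G₁ → ∃ C' T₁ : ℝ, ∀ T : ℝ, T₁ ≤ T → ∃ g : ℝ → ℝ, MeasureTheory.IntegrableOn g (Set.Ioc T (2 * T + 1)) ∧ (∀ t ∈ Set.Icc T (2 * T + 1), ((∫ u : ℝ, k u * E (t + u) * Literature.NumberTheory.LFunctions.hardyZ (t + u)) * (t ^ (-(7 : ℝ) / 4) * Real.exp (Real.pi * t / 4))) ^ 2 ≤ g t) ∧ ∫ t in Set.Ioc T (2 * T + 1), g t ≤ C' * T :=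
  fun ha hkm hk hEc hE0 hmaj henv hc₀ hG5 hG3 hG4 hG₀ hG₁ => UniversalFactor.narrowUpper_kernel_bound_of ha hkm hk hEc hE0 hmaj henv hc₀ hG5 hG3 hG4 hG₀ hG₁

end Summit.RiemannHypothesis.RiemannHypothesis.Theorems
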